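import Mathlib.RepresentationTheory.Character
import Mathlib.RepresentationTheory.Irreducible
import Mathlib.RepresentationTheory.Maschke
import Mathlib.RingTheory.SimpleModule.Basic
import Literature.NumberTheory.DiophantineGeometry.SymmetricGroupRepsCompletenessProofs
import Literature.NumberTheory.DiophantineGeometry.SymmetricGroupRepsFinrankSpechtProofs
import Literature.NumberTheory.DiophantineGeometry.SymmetricGroupRepsKroneckerCharacterProofs
import HarnessLib

/-!
# Character sums `∑_π χ^λ(π) ρ(π)` as isotypic projectors for representations of `S_d`

Topic file in the `SymmetricGroupReps` series (trunk ArithGeomL / CplxAlg). For a partition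
`λ ⊢ d` with Specht character `χ^λ` and a finite-dimensional representation `ρ` of
`S_d = Equiv.Perm (Fin d)` over an algebraically closed field `k` of characteristic zero, the
operator `Z_λ = ∑_π χ^λ(π) ρ(π)` is `d!/f^λ` times the projector onto the `λ`-isotypic component
(`e_λ = (f^λ/d!) ∑_π χ^λ(π⁻¹) π` is the central primitive idempotent of `k[S_d]` attached to
`S^λ`; `χ^λ(π⁻¹) = χ^λ(π)` for `S_d`). This file proves the operator identities that express this,
without introducing definitions (the sum is written out):

* `charSum_comp_rep` — `Z_λ` commutes with `ρ` (characters are class functions);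
* `charSum_spechtRep` — **Schur + orthogonality**: on the Specht module `S^μ`,
  `Z_λ = δ_{λμ} (d!/f^μ) · id` (Schur's lemma, Mathlib's
  `IsIrreducible.algebraMap_intertwiningMap_bijective_of_isAlgClosed`, the trace, and Mathlib's
  `Representation.char_orthonormal` with the tree's `isIrreducible_spechtRep_holds`,
  `nonempty_equiv_iff_holds`, `finrank_spechtIdeal_holds`, `spechtCharacter_inv`);
  `charSum_eq_smul_of_equiv` transports this to any representation isomorphic to `S^μ`;
* `intertwiningMap_eq_zero_of_comp_spechtRep` — an endomorphism of `ρ` that kills every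
  equivariant image of every Specht module is zero (Maschke: `ρ.asModule` is the sum of its simple
  submodules, Mathlib's `IsSemisimpleModule.sSup_simples_eq_top`; completeness of the Specht
  modules, the tree's `exists_equiv_spechtRep_of_isIrreducible_holds`);
* consequences for every finite-dimensional `ρ`: `charSum_comp_charSum_self`
  (`Z_λ² = (d!/f^λ) Z_λ`), `charSum_comp_charSum_of_ne` (`Z_λ Z_μ = 0`, `λ ≠ μ`),
  `sum_smul_charSum_eq_id` (`∑_λ (f^λ/d!) Z_λ = id`, the isotypic decomposition), and
  `charSum_apply_of_mem_range`.

These are Fulton–Harris, *Representation Theory*, §2.4, Prop. 2.32 with Thm. 2.30 (the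
projection formulas `(dim W/|G|) ∑_g χ_W(g)⁻ · g`), specialised to `S_d` whose characters are
real. [cite: FultonHarrisGTM129, §2.4 Prop. 2.32]

Downstream use: the majorisation property of the isotypic projectors on tensor powers
(Christandl–Vrana–Zuiddam, Remark 3.33) in `Literature/Computability/AlgebraicComplexity`.
-/

noncomputable section

open scoped BigOperators

namespace Literature.NumberTheory.DiophantineGeometry

section CharSum

variable {k : Type*} [Field k] {d : ℕ}
variable {V : Type*} [AddCommGroup V] [Module k V]

/-! ### The character sum commutes with the representation -/

/-- The character sum `Z_λ = ∑_π χ^λ(π) ρ(π)` applied to a vector. [folklore] -/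
theorem charSum_apply (ρ : Representation k (Equiv.Perm (Fin d)) V) (lam : Nat.Partition d)
    (v : V) :
    (∑ π, spechtCharacter k lam π • ρ π) v = ∑ π, spechtCharacter k lam π • ρ π v := by
  rw [LinearMap.sum_apply]
  rfl

/-- `Z_λ = ∑_π χ^λ(π) ρ(π)` commutes with every `ρ(σ)`: the character is a class function, so the
sum is invariant under the reindexing `π ↦ σ π σ⁻¹` (Fulton–Harris, proof of Prop. 2.32:
`∑ χ(g)⁻ g` is central). [cite: FultonHarrisGTM129, §2.4 Prop. 2.32 (proof)] -/
theorem charSum_comp_rep (ρ : Representation k (Equiv.Perm (Fin d)) V) (lam : Nat.Partition d)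
    (σ : Equiv.Perm (Fin d)) :
    (∑ π, spechtCharacter k lam π • ρ π) ∘ₗ ρ σ = ρ σ ∘ₗ (∑ π, spechtCharacter k lam π • ρ π) := by
  apply LinearMap.ext
  intro v
  rw [LinearMap.comp_apply, LinearMap.comp_apply, charSum_apply, charSum_apply, map_sum]
  simp only [map_smul]
  -- `ρ π (ρ σ v) = ρ (π σ) v` and `ρ σ (ρ π v) = ρ (σ π) v`
  have h1 : ∀ π : Equiv.Perm (Fin d), ρ π (ρ σ v) = ρ (π * σ) v := fun π => by
    rw [map_mul]; rfl
  have h2 : ∀ π : Equiv.Perm (Fin d), ρ σ (ρ π v) = ρ (σ * π) v := fun π => by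
    rw [map_mul]; rfl
  simp only [h1, h2]
  -- reindex the right-hand sum along `π ↦ σ π σ⁻¹`
  have hbij : Function.Bijective fun π : Equiv.Perm (Fin d) => σ * π * σ⁻¹ :=
    ⟨fun a b hab => by simpa using hab, fun c => ⟨σ⁻¹ * c * σ, by group⟩⟩
  symm
  refine Fintype.sum_bijective _ hbij _ _ fun π => ?_
  rw [spechtCharacter_conj, inv_mul_cancel_right]

/-- Naturality: an intertwining map `f : ρ → ρ'` carries `Z_λ^ρ` to `Z_λ^{ρ'}`. [folklore] -/
theorem intertwiningMap_charSum_apply {W : Type*} [AddCommGroup W] [Module k W]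
    {ρ : Representation k (Equiv.Perm (Fin d)) V} {ρ' : Representation k (Equiv.Perm (Fin d)) W}
    (f : ρ.IntertwiningMap ρ') (lam : Nat.Partition d) (v : V) :
    f ((∑ π, spechtCharacter k lam π • ρ π) v) = (∑ π, spechtCharacter k lam π • ρ' π) (f v) := by
  rw [charSum_apply, charSum_apply, map_sum]
  simp only [map_smul, f.isIntertwining]

/-! ### Schur's lemma and orthogonality on a Specht module -/

/-- **`Z_λ` on the Specht module `S^μ` is the scalar `δ_{λμ} d!/f^μ`** (algebraically closed `k` of
characteristic zero). By Schur's lemma `Z_λ = c · id` on the irreducible `S^μ`; taking traces,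
`c f^μ = ∑_π χ^λ(π) χ^μ(π) = ∑_π χ^λ(π) χ^μ(π⁻¹) = d! · δ_{λμ}` by the orthogonality relations and
the pairwise non-isomorphy of the Specht modules (Fulton–Harris Thm. 2.12, Prop. 2.32, Thm. 4.3).
[cite: FultonHarrisGTM129, §2.4 Prop. 2.32] -/
theorem charSum_spechtRep [IsAlgClosed k] [CharZero k] (lam μ : Nat.Partition d) :
    (∑ π, spechtCharacter k lam π • spechtRep k μ π :
        Module.End k (spechtIdeal k μ)) =
      (if lam = μ then (d.factorial : k) / (numStandardTableaux μ : k) else 0) • LinearMap.id := by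
  classical
  haveI : (spechtRep k μ).IsIrreducible := isIrreducible_spechtRep_holds (k := k) μ
  haveI : (spechtRep k lam).IsIrreducible := isIrreducible_spechtRep_holds (k := k) lam
  -- `Z` as an intertwining self-map of `S^μ`
  set Zl : Module.End k (spechtIdeal k μ) := ∑ π, spechtCharacter k lam π • spechtRep k μ π
    with hZl
  let Z : (spechtRep k μ).IntertwiningMap (spechtRep k μ) :=
    ⟨Zl, fun g => charSum_comp_rep (spechtRep k μ) lam g⟩
  -- Schur: `Z = c • 1`
  obtain ⟨c, hc⟩ :=
    (Representation.IsIrreducible.algebraMap_intertwiningMap_bijective_of_isAlgClosed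
      (ρ := spechtRep k μ)).2 Z
  have hZ : Zl = c • LinearMap.id := by
    have h := congrArg Representation.IntertwiningMap.toLinearMap hc
    rw [Representation.IntertwiningMap.algebraMap_apply,
      Representation.IntertwiningMap.toLinearMap_smul] at h
    -- `h : c • (1 : IntertwiningMap).toLinearMap = Z.toLinearMap`
    rw [show Zl = Z.toLinearMap from rfl, ← h]
    rfl
  -- traces: `tr Z = c · f^μ`
  have hfin : Module.finrank k (spechtIdeal k μ) = numStandardTableaux μ :=
    finrank_spechtIdeal_holds (k := k) μ
  have htr1 : LinearMap.trace k _ Zl = c * (numStandardTableaux μ : k) := by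
    rw [hZ, map_smul, LinearMap.trace_id, hfin, smul_eq_mul]
  have htr2 : LinearMap.trace k _ Zl = ∑ π, spechtCharacter k lam π * spechtCharacter k μ π := by
    rw [hZl, map_sum]
    refine Finset.sum_congr rfl fun π _ => ?_
    rw [map_smul, smul_eq_mul, spechtCharacter_apply k μ π]
  -- orthogonality
  have hcard_pos : (Nat.card (Equiv.Perm (Fin d)) : k) ≠ 0 := Nat.cast_ne_zero.2 Nat.card_pos.ne'
  letI : Invertible (Nat.card (Equiv.Perm (Fin d)) : k) := invertibleOfNonzero hcard_pos
  have horth := Representation.char_orthonormal (spechtRep k lam) (spechtRep k μ)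
  have hsum : ∑ π, spechtCharacter k lam π * spechtCharacter k μ π =
      (Nat.card (Equiv.Perm (Fin d)) : k) * (if lam = μ then 1 else 0) := by
    have h1 : ∑ π, spechtCharacter k lam π * spechtCharacter k μ π =
        ∑ π : Equiv.Perm (Fin d), (spechtRep k lam).character π * (spechtRep k μ).character π⁻¹ := by
      refine Finset.sum_congr rfl fun π _ => ?_
      rw [← spechtCharacter_eq_character, ← spechtCharacter_eq_character, spechtCharacter_inv]
    rw [h1]
    have h3 : (Nat.card (Equiv.Perm (Fin d)) : k)⁻¹ *
        ∑ π : Equiv.Perm (Fin d), (spechtRep k lam).character π * (spechtRep k μ).character π⁻¹ =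
        if lam = μ then 1 else 0 := by
      rw [horth]
      by_cases h : lam = μ
      · subst h
        have hne : Nonempty ((spechtRep k lam).Equiv (spechtRep k lam)) :=
          ⟨Representation.Equiv.refl _⟩
        simp [hne]
      · have hne : ¬ Nonempty ((spechtRep k μ).Equiv (spechtRep k lam)) := fun hne =>
          h ((nonempty_equiv_iff_holds (k := k)).1 hne).symm
        simp [hne, h]
    rw [← h3, ← mul_assoc, mul_inv_cancel₀ hcard_pos, one_mul]
  -- solve for `c`
  have hf : (numStandardTableaux μ : k) ≠ 0 :=
    Nat.cast_ne_zero.2 (numStandardTableaux_pos_holds μ).ne'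
  have hcardk : (Nat.card (Equiv.Perm (Fin d)) : k) = (d.factorial : k) := by
    rw [Nat.card_eq_fintype_card, Fintype.card_perm, Fintype.card_fin]
  have hceq : c = if lam = μ then (d.factorial : k) / (numStandardTableaux μ : k) else 0 := by
    have key : c * (numStandardTableaux μ : k) = (d.factorial : k) * (if lam = μ then 1 else 0) := by
      rw [← htr1, htr2, hsum, hcardk]
    split_ifs with h
    · rw [if_pos h, mul_one] at key
      field_simp
      exact key
    · rw [if_neg h, mul_zero] at key
      rcases mul_eq_zero.1 key with h' | h'
      · exact h'
      · exact absurd h' hf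
  rw [← hceq]
  exact hZ

/-- **`Z_λ` on any representation isomorphic to `S^μ`** is the scalar `δ_{λμ} d!/f^μ`.
[cite: FultonHarrisGTM129, §2.4 Prop. 2.32] -/
theorem charSum_eq_smul_of_equiv [IsAlgClosed k] [CharZero k]
    (ρ : Representation k (Equiv.Perm (Fin d)) V) {μ : Nat.Partition d}
    (e : ρ.Equiv (spechtRep k μ)) (lam : Nat.Partition d) :
    (∑ π, spechtCharacter k lam π • ρ π : Module.End k V) =
      (if lam = μ then (d.factorial : k) / (numStandardTableaux μ : k) else 0) • LinearMap.id := by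
  apply LinearMap.ext
  intro v
  apply EquivLike.injective e
  have h : e ((∑ π, spechtCharacter k lam π • ρ π) v) =
      (∑ π, spechtCharacter k lam π • spechtRep k μ π) (e v) :=
    intertwiningMap_charSum_apply e.toIntertwiningMap lam v
  rw [h, charSum_spechtRep]
  simp only [LinearMap.smul_apply, LinearMap.id_coe, id_eq, map_smul]

/-! ### An endomorphism killing all Specht constituents is zero -/

/-- The group algebra acts on `ofModule' M` through the given module structure of `M`
(unfolding of Mathlib's `Representation.ofModule'`). [folklore] -/
theorem asAlgebraHom_ofModule' {G : Type*} [Group G] (M : Type*) [AddCommGroup M] [Module k M]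
    [Module (MonoidAlgebra k G) M] [IsScalarTower k (MonoidAlgebra k G) M] :
    (Representation.ofModule' (k := k) (G := G) M).asAlgebraHom =
      Algebra.lsmul k k M := by
  rw [Representation.asAlgebraHom_def, Representation.ofModule']
  exact Equiv.apply_symm_apply _ _

/-- `ofModule' M g v = (single g 1) • v`. [folklore] -/
theorem ofModule'_apply {G : Type*} [Group G] (M : Type*) [AddCommGroup M] [Module k M]
    [Module (MonoidAlgebra k G) M] [IsScalarTower k (MonoidAlgebra k G) M] (g : G) (v : M) :
    Representation.ofModule' (k := k) (G := G) M g v = (MonoidAlgebra.single g (1 : k)) • v := by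
  rw [Representation.ofModule', MonoidAlgebra.lift_symm_apply, Algebra.lsmul_coe]

/-- **An intertwining self-map of a finite-dimensional representation of `S_d` (algebraically
closed field of characteristic zero) that vanishes on every equivariant image of every Specht
module is zero.** By Maschke's theorem `ρ.asModule` is the sum of its simple `k[S_d]`-submodules,
each of which is an irreducible representation, hence (completeness, Fulton–Harris Thm. 4.3)
isomorphic to some `S^μ`. [cite: FultonHarrisGTM129, Theorem 4.3 with Prop. 1.5 (Maschke)] -/
theorem intertwiningMap_eq_zero_of_comp_spechtRep [IsAlgClosed k] [CharZero k]
    [FiniteDimensional k V] (ρ : Representation k (Equiv.Perm (Fin d)) V)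
    (T : ρ.IntertwiningMap ρ)
    (hT : ∀ (μ : Nat.Partition d) (ι : (spechtRep k μ).IntertwiningMap ρ) (x : spechtIdeal k μ),
      T (ι x) = 0) :
    T = 0 := by
  classical
  set G := Equiv.Perm (Fin d)
  haveI : NeZero (Nat.card G : k) := ⟨Nat.cast_ne_zero.2 Nat.card_pos.ne'⟩
  -- `T` as a `k[G]`-linear map
  set T' : ρ.asModule →ₗ[MonoidAlgebra k G] ρ.asModule :=
    Representation.IntertwiningMap.equivLinearMapAsModule ρ ρ T with hT'
  have hT'app : ∀ v : ρ.asModule, T' v = T v := fun v => rfl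
  -- every simple submodule lies in the kernel
  have hker : ∀ m : Submodule (MonoidAlgebra k G) ρ.asModule,
      IsSimpleModule (MonoidAlgebra k G) m → m ≤ LinearMap.ker T' := by
    intro m hm v hv
    rw [LinearMap.mem_ker, hT'app]
    -- the irreducible representation on `m`
    haveI : FiniteDimensional k m :=
      Module.Finite.of_injective (m.subtype.restrictScalars k) Subtype.val_injective
    let ρm : Representation k G m := Representation.ofModule' (k := k) (G := G) m
    -- `(ρm).asModule ≃ₗ[k[G]] m`, hence `ρm` is irreducible
    let em : ρm.asModule ≃ₗ[MonoidAlgebra k G] m :=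
      { toFun := ρm.asModuleEquiv
        invFun := ρm.asModuleEquiv.symm
        map_add' := map_add _
        map_smul' := fun x w => by
          rw [Representation.asModuleEquiv_map_smul, asAlgebraHom_ofModule', Algebra.lsmul_coe]
          rfl
        left_inv := ρm.asModuleEquiv.left_inv
        right_inv := ρm.asModuleEquiv.right_inv }
    haveI : ρm.IsIrreducible := by
      rw [Representation.irreducible_iff_isSimpleModule_asModule]
      exact IsSimpleModule.congr em
    -- the inclusion `m ↪ V` as an intertwining map
    let ι : ρm.IntertwiningMap ρ :=
      ⟨{ toFun := fun w => ρ.asModuleEquiv (w : ρ.asModule)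
         map_add' := fun a b => by simp
         map_smul' := fun c a => by simp },
        fun g => by
          apply LinearMap.ext
          intro w
          change ρ.asModuleEquiv ((ρm g w : m) : ρ.asModule) = ρ g (ρ.asModuleEquiv (w : ρ.asModule))
          rw [ofModule'_apply, Submodule.coe_smul, Representation.single_smul, one_smul]
          rfl⟩
    -- completeness: `ρm ≅ S^μ`
    obtain ⟨μ, ⟨e⟩⟩ := exists_equiv_spechtRep_of_isIrreducible_holds (k := k) ρm
    have h := hT μ (ι.comp e.symm.toIntertwiningMap) (e ⟨v, hv⟩)
    rw [Representation.IntertwiningMap.comp_apply] at h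
    have he : e.symm.toIntertwiningMap (e ⟨v, hv⟩) = ⟨v, hv⟩ := e.symm_apply_apply ⟨v, hv⟩
    rw [he] at h
    exact h
  have htop : LinearMap.ker T' = ⊤ := by
    rw [eq_top_iff, ← IsSemisimpleModule.sSup_simples_eq_top (MonoidAlgebra k G) ρ.asModule]
    exact sSup_le fun m hm => hker m hm
  -- conclude
  apply Representation.IntertwiningMap.ext
  apply LinearMap.ext
  intro v
  have hv : ρ.asModuleEquiv.symm v ∈ LinearMap.ker T' := by
    rw [htop]; exact Submodule.mem_top
  exact LinearMap.mem_ker.1 hv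

/-! ### Consequences: the isotypic projector identities -/

/-- The scalar `d!/f^λ` is nonzero in characteristic zero. [folklore] -/
theorem factorial_div_numStandardTableaux_ne_zero [CharZero k] (lam : Nat.Partition d) :
    (d.factorial : k) / (numStandardTableaux lam : k) ≠ 0 :=
  div_ne_zero (Nat.cast_ne_zero.2 (Nat.factorial_pos d).ne')
    (Nat.cast_ne_zero.2 (numStandardTableaux_pos_holds lam).ne')

/-- `Z_λ` composed with an intertwining map out of `S^μ` is the scalar `δ_{λμ} d!/f^μ`. [folklore] -/
theorem charSum_comp_intertwiningMap_spechtRep [IsAlgClosed k] [CharZero k]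
    (ρ : Representation k (Equiv.Perm (Fin d)) V)
    (lam μ : Nat.Partition d) (ι : (spechtRep k μ).IntertwiningMap ρ) (x : spechtIdeal k μ) :
    (∑ π, spechtCharacter k lam π • ρ π) (ι x) =
      (if lam = μ then (d.factorial : k) / (numStandardTableaux μ : k) else 0) • ι x := by
  rw [← intertwiningMap_charSum_apply ι lam x, charSum_spechtRep]
  simp only [LinearMap.smul_apply, LinearMap.id_coe, id_eq, map_smul]

variable [IsAlgClosed k] [CharZero k] [FiniteDimensional k V]

/-- **`Z_λ² = (d!/f^λ) Z_λ`** on every finite-dimensional representation of `S_d`: `(f^λ/d!) Z_λ`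
is an idempotent (the isotypic projector). [cite: FultonHarrisGTM129, §2.4 Prop. 2.32] -/
theorem charSum_comp_charSum_self (ρ : Representation k (Equiv.Perm (Fin d)) V)
    (lam : Nat.Partition d) :
    (∑ π, spechtCharacter k lam π • ρ π) ∘ₗ (∑ π, spechtCharacter k lam π • ρ π) =
      ((d.factorial : k) / (numStandardTableaux lam : k)) • (∑ π, spechtCharacter k lam π • ρ π) := by
  set Zl : Module.End k V := ∑ π, spechtCharacter k lam π • ρ π with hZl
  let Z : ρ.IntertwiningMap ρ := ⟨Zl, fun g => charSum_comp_rep ρ lam g⟩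
  set c : k := (d.factorial : k) / (numStandardTableaux lam : k) with hc
  have key : Z * Z - c • Z = 0 := by
    refine intertwiningMap_eq_zero_of_comp_spechtRep ρ _ fun μ ι x => ?_
    change Zl (Zl (ι x)) - c • Zl (ι x) = 0
    rw [hZl, charSum_comp_intertwiningMap_spechtRep ρ lam μ ι x, map_smul,
      charSum_comp_intertwiningMap_spechtRep ρ lam μ ι x, smul_smul, smul_smul, ← sub_smul]
    by_cases h : lam = μ
    · subst h
      simp [hc]
    · simp [h]
  have h := congrArg Representation.IntertwiningMap.toLinearMap (sub_eq_zero.1 key)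
  exact h

/-- **`Z_λ Z_μ = 0` for `λ ≠ μ`** on every finite-dimensional representation of `S_d`
(orthogonality of the isotypic projectors). [cite: FultonHarrisGTM129, §2.4 Prop. 2.32] -/
theorem charSum_comp_charSum_of_ne (ρ : Representation k (Equiv.Perm (Fin d)) V)
    {lam μ : Nat.Partition d} (hne : lam ≠ μ) :
    (∑ π, spechtCharacter k lam π • ρ π) ∘ₗ (∑ π, spechtCharacter k μ π • ρ π) = 0 := by
  set Zl : Module.End k V := ∑ π, spechtCharacter k lam π • ρ π with hZl
  set Zm : Module.End k V := ∑ π, spechtCharacter k μ π • ρ π with hZm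
  let Z1 : ρ.IntertwiningMap ρ := ⟨Zl, fun g => charSum_comp_rep ρ lam g⟩
  let Z2 : ρ.IntertwiningMap ρ := ⟨Zm, fun g => charSum_comp_rep ρ μ g⟩
  have key : Z1 * Z2 = 0 := by
    refine intertwiningMap_eq_zero_of_comp_spechtRep ρ _ fun ν ι x => ?_
    change Zl (Zm (ι x)) = 0
    rw [hZm, charSum_comp_intertwiningMap_spechtRep ρ μ ν ι x, map_smul, hZl,
      charSum_comp_intertwiningMap_spechtRep ρ lam ν ι x, smul_smul]
    by_cases h1 : lam = ν
    · subst h1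
      simp [Ne.symm hne]
    · simp [h1]
  exact congrArg Representation.IntertwiningMap.toLinearMap key

/-- **Isotypic decomposition** `∑_λ (f^λ/d!) Z_λ = id` on every finite-dimensional representation
of `S_d` over an algebraically closed field of characteristic zero (the central idempotents `e_λ`
of the simple components sum to `1`; Fulton–Harris Prop. 2.32 with Cor. 2.18).
[cite: FultonHarrisGTM129, §2.4 Prop. 2.32] -/
theorem sum_smul_charSum_eq_id (ρ : Representation k (Equiv.Perm (Fin d)) V) :
    ∑ lam : Nat.Partition d, ((numStandardTableaux lam : k) / (d.factorial : k)) •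
        (∑ π, spechtCharacter k lam π • ρ π) = (LinearMap.id : Module.End k V) := by
  classical
  set Sl : Module.End k V := ∑ lam : Nat.Partition d,
    ((numStandardTableaux lam : k) / (d.factorial : k)) • (∑ π, spechtCharacter k lam π • ρ π)
    with hSl
  have hcomm : ∀ g : Equiv.Perm (Fin d), Sl ∘ₗ ρ g = ρ g ∘ₗ Sl := by
    intro g
    apply LinearMap.ext
    intro v
    rw [LinearMap.comp_apply, LinearMap.comp_apply, hSl, LinearMap.sum_apply, LinearMap.sum_apply,
      map_sum]
    refine Finset.sum_congr rfl fun lam _ => ?_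
    rw [LinearMap.smul_apply, LinearMap.smul_apply, map_smul]
    congr 1
    exact LinearMap.congr_fun (charSum_comp_rep ρ lam g) v
  let S : ρ.IntertwiningMap ρ := ⟨Sl, hcomm⟩
  have key : S - 1 = 0 := by
    refine intertwiningMap_eq_zero_of_comp_spechtRep ρ _ fun ν ι x => ?_
    change Sl (ι x) - ι x = 0
    rw [hSl, LinearMap.sum_apply, sub_eq_zero]
    have hterm : ∀ lam : Nat.Partition d,
        (((numStandardTableaux lam : k) / (d.factorial : k)) •
            (∑ π, spechtCharacter k lam π • ρ π)) (ι x) =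
          if lam = ν then ι x else 0 := by
      intro lam
      rw [LinearMap.smul_apply, charSum_comp_intertwiningMap_spechtRep ρ lam ν ι x, smul_smul]
      by_cases h : lam = ν
      · subst h
        have hf : (numStandardTableaux lam : k) ≠ 0 :=
          Nat.cast_ne_zero.2 (numStandardTableaux_pos_holds lam).ne'
        have hd : (d.factorial : k) ≠ 0 := Nat.cast_ne_zero.2 (Nat.factorial_pos d).ne'
        rw [if_pos rfl, if_pos rfl, show (numStandardTableaux lam : k) / (d.factorial : k) *
          ((d.factorial : k) / (numStandardTableaux lam : k)) = 1 by field_simp, one_smul]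
      · rw [if_neg h, if_neg h, mul_zero, zero_smul]
    rw [Finset.sum_congr rfl fun lam _ => hterm lam, Finset.sum_ite_eq' Finset.univ ν]
    simp
  exact congrArg Representation.IntertwiningMap.toLinearMap (sub_eq_zero.1 key)

/-- On its own range `Z_λ` acts as the scalar `d!/f^λ`. [folklore] -/
theorem charSum_apply_of_mem_range (ρ : Representation k (Equiv.Perm (Fin d)) V)
    (lam : Nat.Partition d) {v : V}
    (hv : v ∈ LinearMap.range (∑ π, spechtCharacter k lam π • ρ π)) :
    (∑ π, spechtCharacter k lam π • ρ π) v =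
      ((d.factorial : k) / (numStandardTableaux lam : k)) • v := by
  obtain ⟨w, rfl⟩ := hv
  have h := LinearMap.congr_fun (charSum_comp_charSum_self ρ lam) w
  rw [LinearMap.comp_apply, LinearMap.smul_apply] at h
  exact h

/-- `Z_μ` kills the range of `Z_λ` for `λ ≠ μ`. [folklore] -/
theorem charSum_apply_eq_zero_of_mem_range_of_ne (ρ : Representation k (Equiv.Perm (Fin d)) V)
    {lam μ : Nat.Partition d} (hne : μ ≠ lam) {v : V}
    (hv : v ∈ LinearMap.range (∑ π, spechtCharacter k lam π • ρ π)) :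
    (∑ π, spechtCharacter k μ π • ρ π) v = 0 := by
  obtain ⟨w, rfl⟩ := hv
  have h := LinearMap.congr_fun (charSum_comp_charSum_of_ne ρ hne) w
  rw [LinearMap.comp_apply, LinearMap.zero_apply] at h
  exact h

end CharSum

end Literature.NumberTheory.DiophantineGeometry

end
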